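import Mathlib
import Summits.ValiantsHypothesis.ValiantsHypothesis.Theses.FreeSubtorus
import Literature.Computability.AlgebraicComplexity.GrenetEquivariant
import Literature.Computability.AlgebraicComplexity.DetReprEquivalent
import Literature.Computability.AlgebraicComplexity.AlperBogartVelascoProofs
import Literature.Computability.AlgebraicComplexity.DeterminantalComplexityProofs
import Literature.FieldTheory.Kummer.AbelianRadicalDescent

/-!
# `FreeSubtorus.OrbitDimensionBound` (crux stmt-ValiantsHypothesis-16133) — proved slices and the
# reduction to optimal size

Helper file for the crux (`--supports`); it closes nothing by itself.  Write `T_Λ` for the crux's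
subtorus `Subgroup.closure {γ | ∃ d e : Fin n → ℂˣ, (∀ i, χ_{Λ i}(d,e) = 1) ∧ γ = diag(d_k e_l)}` and
`Concl n m` for the crux's conclusion at `(n, m)` (some size-`m` representation of `per_n` is
`T_Λ`-equivariant for some admissible `Λ` with `r ≤ n/2` generators).

* `IsEquivariantDetRepr.pad` — padding `A ↦ A ⊕ 1_c` keeps `Γ`-equivariance (lifts `g ⊕ 1`, `h ⊕ 1`);
  `HasEquivariantDetRepr.of_le` — hence `HasEquivariantDetRepr Γ f m → m ≤ m' → HasEquivariantDetRepr Γ f m'`.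
* `concl_mono` — `Concl n m → m ≤ m' → Concl n m'`.
* `concl_of_two_pow_le` — `Concl n m` for all `n ≥ 1`, `m ≥ 2ⁿ - 1`, with `r = 0` (Grenet's
  representation is two-sided-torus equivariant, `Grenet.isEquivariantDetRepr_repr`, then pad).
* `orbitDimensionBound_three` — the slice `n = 3` of the crux holds outright (`dc(per_3) = 7 = 2³ - 1`,
  Alper–Bogart–Velasco, tree theorem `seven_le_determinantalComplexity_perPoly_three`).
* `orbitDimensionBound_iff_optimalSize` — the crux is equivalent to its `m = dc(per_n)` instance:
  `∀ n ≥ 3, ∃ admissible Λ, r ≤ n/2, HasEquivariantDetRepr T_Λ per_n (dc per_n)`.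
* `orbitDimensionBound_of_four_le` — it suffices to prove the crux for `n ≥ 4`.
* `homothetyLifts_of_orbitDimensionBound` — NECESSARY CONDITION (refuter's vetting note, made a tree
  theorem): every admissible `T_Λ` contains the homotheties `x ↦ c x` (zero row-sums), so the crux
  forces, at every size `m ≥ dc(per_n)`, a representation on which all homotheties lift exactly.
-/

-- Sub = Summit single-conjunct layout: the duplicated namespace component is mandated by the tree.
set_option linter.dupNamespace false

noncomputable section

namespace Summit.ValiantsHypothesis.ValiantsHypothesis.Theorems.FreeSubtorusOrbitDimensionBound

open Matrix MvPolynomial Finset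
open Literature.Computability.AlgebraicComplexity

/-! ### Padding keeps equivariance -/

section Pad

variable {k : Type*} [CommRing k] {σ : Type*} [Fintype σ] [DecidableEq σ]
  {Γ : Subgroup (GL σ k)} {f : MvPolynomial σ k} {m : ℕ}
  {A : Matrix (Fin m) (Fin m) (MvPolynomial σ k)}

/-- Reindexed block-diagonal matrices multiply blockwise: `(X ⊕ 1)(Y ⊕ 1) = (XY ⊕ 1)` after
reindexing along `Fin m ⊕ Fin c ≃ Fin (m + c)`. [folklore] -/
theorem reindex_fromBlocks_one_mul {R : Type*} [CommRing R] {c : ℕ} (X Y : Matrix (Fin m) (Fin m) R) :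
    Matrix.reindex finSumFinEquiv finSumFinEquiv (Matrix.fromBlocks X 0 0 (1 : Matrix (Fin c) (Fin c) R)) *
      Matrix.reindex finSumFinEquiv finSumFinEquiv (Matrix.fromBlocks Y 0 0 (1 : Matrix (Fin c) (Fin c) R)) =
      Matrix.reindex finSumFinEquiv finSumFinEquiv (Matrix.fromBlocks (X * Y) 0 0 (1 : Matrix (Fin c) (Fin c) R)) := by
  simp only [Matrix.reindex_apply, Matrix.submatrix_mul_equiv, Matrix.fromBlocks_multiply]
  congr 1
  simp

/-- An entrywise map fixing `0` and `1` commutes with the reindexed padding `X ↦ X ⊕ 1`. [folklore] -/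
theorem reindex_fromBlocks_one_map {R S : Type*} [Zero R] [One R] [Zero S] [One S] {c : ℕ}
    (X : Matrix (Fin m) (Fin m) R) {φ : R → S} (h0 : φ 0 = 0) (h1 : φ 1 = 1) :
    (Matrix.reindex finSumFinEquiv finSumFinEquiv (Matrix.fromBlocks X 0 0 (1 : Matrix (Fin c) (Fin c) R))).map φ =
      Matrix.reindex finSumFinEquiv finSumFinEquiv (Matrix.fromBlocks (X.map φ) 0 0 (1 : Matrix (Fin c) (Fin c) S)) := by
  rw [Matrix.reindex_apply, Matrix.reindex_apply, ← Matrix.submatrix_map, Matrix.fromBlocks_map,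
    Matrix.map_zero φ h0, Matrix.map_zero φ h0, Matrix.map_one φ h0 h1]

/-- **Padding keeps equivariance.**  If `A` is a `Γ`-equivariant affine determinantal representation of
`f` of size `m`, so is the block-diagonal matrix `A ⊕ 1_c` of size `m + c`: the entries stay affine,
`det (A ⊕ 1) = det A`, and a lift `(g, h)` of `γ` on `A` pads to the lift `(g ⊕ 1, h ⊕ 1)` on `A ⊕ 1`
(the substitution fixes the constants `0, 1`). [cite: LandsbergRessayre2017, Def. 1.3]
[cite: MignonRessayre2004, §1] -/
theorem IsEquivariantDetRepr.pad (hA : IsEquivariantDetRepr Γ f A) (c : ℕ) :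
    IsEquivariantDetRepr Γ f
      (Matrix.reindex finSumFinEquiv finSumFinEquiv (Matrix.fromBlocks A 0 0 (1 : Matrix (Fin c) (Fin c) _))) := by
  refine ⟨⟨fun i j => ?_, ?_⟩, fun γ hγ => ?_⟩
  · -- affine entries: those of `A`, `0` or `1`
    rw [Matrix.reindex_apply, Matrix.submatrix_apply]
    generalize finSumFinEquiv.symm i = a
    generalize finSumFinEquiv.symm j = b
    rcases a with a | a <;> rcases b with b | b
    · simpa using hA.1.1 a b
    · simp
    · simp
    · simp only [Matrix.fromBlocks_apply₂₂, Matrix.one_apply]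
      split_ifs <;> simp
  · -- determinant
    rw [Matrix.det_reindex_self, Matrix.det_fromBlocks_zero₂₁, Matrix.det_one, mul_one, hA.1.2]
  · -- lifts pad
    obtain ⟨g, h, hgh⟩ := hA.2 γ hγ
    -- the padded gauge factors as units
    have hunit : ∀ u : GL (Fin m) k,
        Matrix.reindex finSumFinEquiv finSumFinEquiv (Matrix.fromBlocks (u : Matrix (Fin m) (Fin m) k) 0 0
            (1 : Matrix (Fin c) (Fin c) k)) *
          Matrix.reindex finSumFinEquiv finSumFinEquiv (Matrix.fromBlocks ((u⁻¹ : GL (Fin m) k) : Matrix (Fin m) (Fin m) k)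
            0 0 (1 : Matrix (Fin c) (Fin c) k)) = 1 := by
      intro u
      rw [reindex_fromBlocks_one_mul, ← Units.val_mul, mul_inv_cancel, Units.val_one, Matrix.fromBlocks_one]
      simp
    have hunit' : ∀ u : GL (Fin m) k,
        Matrix.reindex finSumFinEquiv finSumFinEquiv (Matrix.fromBlocks ((u⁻¹ : GL (Fin m) k) : Matrix (Fin m) (Fin m) k)
            0 0 (1 : Matrix (Fin c) (Fin c) k)) *
          Matrix.reindex finSumFinEquiv finSumFinEquiv (Matrix.fromBlocks (u : Matrix (Fin m) (Fin m) k) 0 0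
            (1 : Matrix (Fin c) (Fin c) k)) = 1 := by
      intro u
      rw [reindex_fromBlocks_one_mul, ← Units.val_mul, inv_mul_cancel, Units.val_one, Matrix.fromBlocks_one]
      simp
    refine ⟨⟨_, _, hunit g, hunit' g⟩, ⟨_, _, hunit h, hunit' h⟩, ?_⟩
    -- `↑(⟨a, b, _, _⟩⁻¹) = b` definitionally
    show (Matrix.reindex finSumFinEquiv finSumFinEquiv (Matrix.fromBlocks A 0 0 (1 : Matrix (Fin c) (Fin c) _))).map
        (linSubst σ k (γ : Matrix σ σ k)) =
      (Matrix.reindex finSumFinEquiv finSumFinEquiv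
          (Matrix.fromBlocks (g : Matrix (Fin m) (Fin m) k) 0 0 (1 : Matrix (Fin c) (Fin c) k))).map C *
        Matrix.reindex finSumFinEquiv finSumFinEquiv (Matrix.fromBlocks A 0 0 (1 : Matrix (Fin c) (Fin c) _)) *
        (Matrix.reindex finSumFinEquiv finSumFinEquiv
          (Matrix.fromBlocks ((h⁻¹ : GL (Fin m) k) : Matrix (Fin m) (Fin m) k) 0 0 (1 : Matrix (Fin c) (Fin c) k))).map C
    rw [reindex_fromBlocks_one_map _ (map_zero C) (map_one C), reindex_fromBlocks_one_map _ (map_zero C) (map_one C),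
      reindex_fromBlocks_one_map _ (map_zero _) (map_one _), reindex_fromBlocks_one_mul, reindex_fromBlocks_one_mul]
    -- the upper-left block is the lift identity `hgh` (closed by `congr`)
    congr 2

/-- **Equivariant representations pad.**  `HasEquivariantDetRepr Γ f m → m ≤ m' → HasEquivariantDetRepr Γ f m'`.
[cite: LandsbergRessayre2017, §1] -/
theorem HasEquivariantDetRepr.of_le {m' : ℕ} (h : HasEquivariantDetRepr Γ f m) (hm : m ≤ m') :
    HasEquivariantDetRepr Γ f m' := by
  obtain ⟨A, hA⟩ := h
  obtain ⟨c, rfl⟩ := Nat.exists_eq_add_of_le hm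
  exact ⟨_, IsEquivariantDetRepr.pad hA c⟩

end Pad

/-! ### The crux's conclusion: from the two-sided torus, padding, the slices `n = 3` and `m ≥ 2ⁿ - 1` -/

section Slices

/-- A two-sided-torus-equivariant representation (the tree's Grenet subgroup, generators `diag(d_k e_l)`
with `d, e : Fin n → ℂ`) is `T_Λ`-equivariant for the EMPTY admissible `Λ` (`r = 0 ≤ n/2`): the crux's
conclusion at `(n, m)`. [cite: LandsbergRessayre2017, Def. 1.3] -/
theorem concl_of_twoSidedTorus {n m : ℕ} {B : Matrix (Fin m) (Fin m) (MvPolynomial (Fin n × Fin n) ℂ)}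
    (hB : IsEquivariantDetRepr
      (Subgroup.closure {γ : GL (Fin n × Fin n) ℂ | ∃ d e : Fin n → ℂ,
        (γ : Matrix (Fin n × Fin n) (Fin n × Fin n) ℂ) = Matrix.diagonal (fun p => d p.1 * e p.2)})
      (perPoly (Fin n) ℂ) B) :
    ∃ (B : Matrix (Fin m) (Fin m) (MvPolynomial (Fin n × Fin n) ℂ)) (r : ℕ) (Λ : Fin r → (Fin n ⊕ Fin n) → ℤ),
      r ≤ n / 2 ∧ (∀ i, (∑ k, Λ i (Sum.inl k)) = 0 ∧ (∑ l, Λ i (Sum.inr l)) = 0) ∧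
      IsEquivariantDetRepr (Subgroup.closure {γ : GL (Fin n × Fin n) ℂ | ∃ d e : Fin n → ℂˣ,
        (∀ i, (∏ k, (d k) ^ (Λ i (Sum.inl k))) * (∏ l, (e l) ^ (Λ i (Sum.inr l))) = 1) ∧
        (γ : Matrix (Fin n × Fin n) (Fin n × Fin n) ℂ) = Matrix.diagonal (fun p => (d p.1 : ℂ) * (e p.2 : ℂ))})
        (perPoly (Fin n) ℂ) B := by
  refine ⟨B, 0, Fin.elim0, Nat.zero_le _, fun i => Fin.elim0 i, hB.anti (Subgroup.closure_mono ?_)⟩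
  rintro γ ⟨d, e, -, hγ⟩
  exact ⟨fun k => (d k : ℂ), fun l => (e l : ℂ), hγ⟩

/-- **The conclusion is monotone in the size** (pad the equivariant representation, same `Λ`).
[cite: MignonRessayre2004, §1] -/
theorem concl_mono {n m m' : ℕ}
    (h : ∃ (B : Matrix (Fin m) (Fin m) (MvPolynomial (Fin n × Fin n) ℂ)) (r : ℕ) (Λ : Fin r → (Fin n ⊕ Fin n) → ℤ),
      r ≤ n / 2 ∧ (∀ i, (∑ k, Λ i (Sum.inl k)) = 0 ∧ (∑ l, Λ i (Sum.inr l)) = 0) ∧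
      IsEquivariantDetRepr (Subgroup.closure {γ : GL (Fin n × Fin n) ℂ | ∃ d e : Fin n → ℂˣ,
        (∀ i, (∏ k, (d k) ^ (Λ i (Sum.inl k))) * (∏ l, (e l) ^ (Λ i (Sum.inr l))) = 1) ∧
        (γ : Matrix (Fin n × Fin n) (Fin n × Fin n) ℂ) = Matrix.diagonal (fun p => (d p.1 : ℂ) * (e p.2 : ℂ))})
        (perPoly (Fin n) ℂ) B)
    (hm : m ≤ m') :
    ∃ (B : Matrix (Fin m') (Fin m') (MvPolynomial (Fin n × Fin n) ℂ)) (r : ℕ) (Λ : Fin r → (Fin n ⊕ Fin n) → ℤ),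
      r ≤ n / 2 ∧ (∀ i, (∑ k, Λ i (Sum.inl k)) = 0 ∧ (∑ l, Λ i (Sum.inr l)) = 0) ∧
      IsEquivariantDetRepr (Subgroup.closure {γ : GL (Fin n × Fin n) ℂ | ∃ d e : Fin n → ℂˣ,
        (∀ i, (∏ k, (d k) ^ (Λ i (Sum.inl k))) * (∏ l, (e l) ^ (Λ i (Sum.inr l))) = 1) ∧
        (γ : Matrix (Fin n × Fin n) (Fin n × Fin n) ℂ) = Matrix.diagonal (fun p => (d p.1 : ℂ) * (e p.2 : ℂ))})
        (perPoly (Fin n) ℂ) B := by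
  obtain ⟨B, r, Λ, hr, hΛ, hB⟩ := h
  obtain ⟨c, rfl⟩ := Nat.exists_eq_add_of_le hm
  exact ⟨_, r, Λ, hr, hΛ, IsEquivariantDetRepr.pad hB c⟩

/-- **The slice `m ≥ 2ⁿ - 1` (`n ≥ 1`) of the crux's conclusion holds with `r = 0`**: Grenet's
`(2ⁿ - 1) × (2ⁿ - 1)` representation is two-sided-torus equivariant
(`Grenet.hasEquivariantDetRepr_perPoly_twoSidedTorus`); pad it. [cite: Grenet2011, Thm. 1]
[cite: LandsbergRessayre2017, §2.2] -/
theorem concl_of_two_pow_le {n : ℕ} (hn : 1 ≤ n) {m : ℕ} (hm : 2 ^ n - 1 ≤ m) :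
    ∃ (B : Matrix (Fin m) (Fin m) (MvPolynomial (Fin n × Fin n) ℂ)) (r : ℕ) (Λ : Fin r → (Fin n ⊕ Fin n) → ℤ),
      r ≤ n / 2 ∧ (∀ i, (∑ k, Λ i (Sum.inl k)) = 0 ∧ (∑ l, Λ i (Sum.inr l)) = 0) ∧
      IsEquivariantDetRepr (Subgroup.closure {γ : GL (Fin n × Fin n) ℂ | ∃ d e : Fin n → ℂˣ,
        (∀ i, (∏ k, (d k) ^ (Λ i (Sum.inl k))) * (∏ l, (e l) ^ (Λ i (Sum.inr l))) = 1) ∧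
        (γ : Matrix (Fin n × Fin n) (Fin n × Fin n) ℂ) = Matrix.diagonal (fun p => (d p.1 : ℂ) * (e p.2 : ℂ))})
        (perPoly (Fin n) ℂ) B := by
  obtain ⟨B, hB⟩ := HasEquivariantDetRepr.of_le
    (Grenet.hasEquivariantDetRepr_perPoly_twoSidedTorus ℂ (n := n) (by omega)) hm
  exact concl_of_twoSidedTorus hB

/-- **The slice `n = 3` of the crux holds**: a representation of `per_3` has size
`m ≥ dc(per_3) ≥ 7 = 2³ - 1` (Alper–Bogart–Velasco, `seven_le_determinantalComplexity_perPoly_three`), so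
the padded Grenet representation serves, with `r = 0`. [cite: AlperBogartVelasco2017, Cor. 1.4]
[cite: Grenet2011, Thm. 1] -/
theorem orbitDimensionBound_three :
    ∀ (m : ℕ) (A : Matrix (Fin m) (Fin m) (MvPolynomial (Fin 3 × Fin 3) ℂ)),
    Literature.Computability.AlgebraicComplexity.IsAffineDetRepr
        (Literature.Computability.AlgebraicComplexity.perPoly (Fin 3) ℂ) A →
    ∃ (B : Matrix (Fin m) (Fin m) (MvPolynomial (Fin 3 × Fin 3) ℂ)) (r : ℕ) (Λ : Fin r → (Fin 3 ⊕ Fin 3) → ℤ),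
      r ≤ 3 / 2 ∧ (∀ i, (∑ k, Λ i (Sum.inl k)) = 0 ∧ (∑ l, Λ i (Sum.inr l)) = 0) ∧
      Literature.Computability.AlgebraicComplexity.IsEquivariantDetRepr
        (Subgroup.closure {γ : Matrix.GeneralLinearGroup (Fin 3 × Fin 3) ℂ | ∃ d e : Fin 3 → ℂˣ,
          (∀ i, (∏ k, (d k) ^ (Λ i (Sum.inl k))) * (∏ l, (e l) ^ (Λ i (Sum.inr l))) = 1) ∧
          (γ : Matrix (Fin 3 × Fin 3) (Fin 3 × Fin 3) ℂ) = Matrix.diagonal (fun p => (d p.1 : ℂ) * (e p.2 : ℂ))})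
        (Literature.Computability.AlgebraicComplexity.perPoly (Fin 3) ℂ) B := by
  intro m A hA
  have h7 : 7 ≤ determinantalComplexity (perPoly (Fin 3) ℂ) :=
    AlperBogartVelasco.seven_le_determinantalComplexity_perPoly_three ℂ two_ne_zero
  have hm : determinantalComplexity (perPoly (Fin 3) ℂ) ≤ m :=
    determinantalComplexity_le_of_hasDetRepr ⟨A, hA⟩
  exact concl_of_two_pow_le (n := 3) (by norm_num) (by norm_num; omega)

/-! ### Reductions of the crux -/

/-- **The crux is its own optimal-size instance.**  `OrbitDimensionBound` holds iff for every `n ≥ 3`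
some admissible `T_Λ` (`r ≤ n/2`) admits an equivariant representation of `per_n` of size exactly
`dc(per_n)`: an optimal representation exists (`hasDetRepr_determinantalComplexity_holds`), and
equivariant representations pad to every `m ≥ dc(per_n)` (`HasEquivariantDetRepr.of_le`), while every
representation has size `≥ dc(per_n)`. [cite: LandsbergRessayre2017, §2 Q2.2] [cite: MignonRessayre2004, §1] -/
theorem orbitDimensionBound_iff_optimalSize :
    Summit.ValiantsHypothesis.ValiantsHypothesis.Theses.FreeSubtorus.OrbitDimensionBound ↔
    ∀ n : ℕ, 3 ≤ n → ∃ (r : ℕ) (Λ : Fin r → (Fin n ⊕ Fin n) → ℤ),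
      r ≤ n / 2 ∧ (∀ i, (∑ k, Λ i (Sum.inl k)) = 0 ∧ (∑ l, Λ i (Sum.inr l)) = 0) ∧
      HasEquivariantDetRepr (Subgroup.closure {γ : GL (Fin n × Fin n) ℂ | ∃ d e : Fin n → ℂˣ,
        (∀ i, (∏ k, (d k) ^ (Λ i (Sum.inl k))) * (∏ l, (e l) ^ (Λ i (Sum.inr l))) = 1) ∧
        (γ : Matrix (Fin n × Fin n) (Fin n × Fin n) ℂ) = Matrix.diagonal (fun p => (d p.1 : ℂ) * (e p.2 : ℂ))})
        (perPoly (Fin n) ℂ) (determinantalComplexity (perPoly (Fin n) ℂ)) := by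
  unfold Summit.ValiantsHypothesis.ValiantsHypothesis.Theses.FreeSubtorus.OrbitDimensionBound
  constructor
  · intro h n hn
    obtain ⟨A, hA⟩ := hasDetRepr_determinantalComplexity_holds (perPoly (Fin n) ℂ)
    obtain ⟨B, r, Λ, hr, hΛ, hB⟩ := h n hn _ A hA
    exact ⟨r, Λ, hr, hΛ, B, hB⟩
  · intro h n hn m A hA
    obtain ⟨r, Λ, hr, hΛ, hopt⟩ := h n hn
    obtain ⟨B, hB⟩ := HasEquivariantDetRepr.of_le hopt (determinantalComplexity_le_of_hasDetRepr ⟨A, hA⟩)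
    exact ⟨B, r, Λ, hr, hΛ, hB⟩

/-- **It suffices to prove the crux for `n ≥ 4`** (the slice `n = 3` is `orbitDimensionBound_three`).
[cite: AlperBogartVelasco2017, Cor. 1.4] -/
theorem orbitDimensionBound_of_four_le
    (h : ∀ n : ℕ, 4 ≤ n → ∀ (m : ℕ) (A : Matrix (Fin m) (Fin m) (MvPolynomial (Fin n × Fin n) ℂ)),
      IsAffineDetRepr (perPoly (Fin n) ℂ) A →
      ∃ (B : Matrix (Fin m) (Fin m) (MvPolynomial (Fin n × Fin n) ℂ)) (r : ℕ) (Λ : Fin r → (Fin n ⊕ Fin n) → ℤ),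
        r ≤ n / 2 ∧ (∀ i, (∑ k, Λ i (Sum.inl k)) = 0 ∧ (∑ l, Λ i (Sum.inr l)) = 0) ∧
        IsEquivariantDetRepr (Subgroup.closure {γ : GL (Fin n × Fin n) ℂ | ∃ d e : Fin n → ℂˣ,
          (∀ i, (∏ k, (d k) ^ (Λ i (Sum.inl k))) * (∏ l, (e l) ^ (Λ i (Sum.inr l))) = 1) ∧
          (γ : Matrix (Fin n × Fin n) (Fin n × Fin n) ℂ) = Matrix.diagonal (fun p => (d p.1 : ℂ) * (e p.2 : ℂ))})
          (perPoly (Fin n) ℂ) B) :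
    Summit.ValiantsHypothesis.ValiantsHypothesis.Theses.FreeSubtorus.OrbitDimensionBound := by
  unfold Summit.ValiantsHypothesis.ValiantsHypothesis.Theses.FreeSubtorus.OrbitDimensionBound
  intro n hn m A hA
  rcases Nat.lt_or_ge n 4 with h3 | h4
  · obtain rfl : n = 3 := by omega
    exact orbitDimensionBound_three m A hA
  · exact h n h4 m A hA

/-! ### Necessary condition: homotheties lift at every size -/

/-- **Homotheties lie in every admissible `T_Λ`.**  For `Λ` with zero row-sums, the torus element
`(d, e) = (c·𝟙, 𝟙)` satisfies every relation (`Π_k c^{Λ_i(inl k)} = c^{Σ_k Λ_i(inl k)} = c⁰ = 1`), and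
`diag(d_k e_l) = c · 1` is the homothety `x ↦ c x`. [cite: LandsbergRessayre2017, §2 Q2.2] -/
theorem homothety_mem_relTorus {n r : ℕ} (Λ : Fin r → (Fin n ⊕ Fin n) → ℤ)
    (hΛ : ∀ i, (∑ k, Λ i (Sum.inl k)) = 0 ∧ (∑ l, Λ i (Sum.inr l)) = 0) (c : ℂˣ)
    (γ : GL (Fin n × Fin n) ℂ) (hγ : (γ : Matrix (Fin n × Fin n) (Fin n × Fin n) ℂ) = Matrix.diagonal (fun _ => (c : ℂ))) :
    γ ∈ Subgroup.closure {γ : GL (Fin n × Fin n) ℂ | ∃ d e : Fin n → ℂˣ,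
        (∀ i, (∏ k, (d k) ^ (Λ i (Sum.inl k))) * (∏ l, (e l) ^ (Λ i (Sum.inr l))) = 1) ∧
        (γ : Matrix (Fin n × Fin n) (Fin n × Fin n) ℂ) = Matrix.diagonal (fun p => (d p.1 : ℂ) * (e p.2 : ℂ))} := by
  refine Subgroup.subset_closure ⟨fun _ => c, fun _ => 1, fun i => ?_, ?_⟩
  · rw [Literature.FieldTheory.Kummer.AbelianRadicalDescent.prod_zpow_eq_zpow_sum, (hΛ i).1, zpow_zero, one_mul]
    exact Finset.prod_eq_one fun l _ => one_zpow _
  · rw [hγ]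
    simp

/-- **Necessary condition for the crux (refuter's vetting note, 2026-08-17): homotheties lift at every
size.**  If `OrbitDimensionBound` holds then for every `n ≥ 3` and every size `m` at which `per_n` has an
affine determinantal representation, some size-`m` representation `B` of `per_n` admits exact
`GL_m × GL_m` lifts of ALL homotheties `x ↦ c x`, `c ∈ ℂˣ` (they lie in every admissible `T_Λ`).
[cite: LandsbergRessayre2017, §2 Q2.2] [cite: IkenmeyerLandsberg2017, §3] -/
theorem homothetyLifts_of_orbitDimensionBound
    (h : Summit.ValiantsHypothesis.ValiantsHypothesis.Theses.FreeSubtorus.OrbitDimensionBound) :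
    ∀ n : ℕ, 3 ≤ n → ∀ (m : ℕ) (A : Matrix (Fin m) (Fin m) (MvPolynomial (Fin n × Fin n) ℂ)),
      IsAffineDetRepr (perPoly (Fin n) ℂ) A →
      ∃ B : Matrix (Fin m) (Fin m) (MvPolynomial (Fin n × Fin n) ℂ), IsAffineDetRepr (perPoly (Fin n) ℂ) B ∧
        ∀ (c : ℂˣ) (γ : GL (Fin n × Fin n) ℂ),
          (γ : Matrix (Fin n × Fin n) (Fin n × Fin n) ℂ) = Matrix.diagonal (fun _ => (c : ℂ)) →
          ∃ g h' : GL (Fin m) ℂ, Matrix.linSubstEntries γ B =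
            (g : Matrix (Fin m) (Fin m) ℂ).map C * B * ((h'⁻¹ : GL (Fin m) ℂ) : Matrix (Fin m) (Fin m) ℂ).map C := by
  intro n hn m A hA
  obtain ⟨B, r, Λ, -, hΛ, hB⟩ := h n hn m A hA
  exact ⟨B, hB.1, fun c γ hγ => hB.2 γ (homothety_mem_relTorus Λ hΛ c γ hγ)⟩

end Slices

end Summit.ValiantsHypothesis.ValiantsHypothesis.Theorems.FreeSubtorusOrbitDimensionBound

end
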